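import Summits.AtomisticToContinuum.HydrodynamicLimit.Theorems.InformationPercolationEngineCollisionRate
import Summits.AtomisticToContinuum.HydrodynamicLimit.Theorems.InformationPercolationEngineCollisionRateTubeRegular
import Summits.AtomisticToContinuum.HydrodynamicLimit.Theorems.InformationPercolationEngineCollisionRateUnitMarkTruncationRung0
import Summits.AtomisticToContinuum.HydrodynamicLimit.Theorems.InformationPercolationEngineCollisionRateCylinderPullbackUnitRung0
import Summits.AtomisticToContinuum.HydrodynamicLimit.Theorems.InformationPercolationEngineCollisionRateMeanEnskogUnitRung0
import Summits.AtomisticToContinuum.HydrodynamicLimit.Theorems.InformationPercolationEngineCollisionRateFixedTimeVarianceUnitRung0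
import Summits.AtomisticToContinuum.HydrodynamicLimit.Theorems.InformationPercolationEngineCollisionRateRung0
import Summits.AtomisticToContinuum.HydrodynamicLimit.Theorems.JParityClosureEvenStressEnskogL2ToProbability
import Summits.AtomisticToContinuum.HydrodynamicLimit.Theorems.OneFlightGossipEngineCollisionActivityTailsAbnormalActivityStatics
import Literature.MathematicalPhysics.KineticTheory.EvenCollisionTubeFunctional
import Literature.Analysis.FluidPDE.HardSphereCollisionRecord
import Literature.MathematicalPhysics.KineticTheory.CollisionFluxMeanBoundNonStationary
import Literature.MathematicalPhysics.KineticTheory.CollisionFluxUpperBound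
import Literature.MathematicalPhysics.KineticTheory.ShortFlightCount
import Literature.MathematicalPhysics.KineticTheory.CollisionTubePullbackDefs
import HarnessLib

/-!
# T2c′: the three-body collision sum under the evolved local Gibbs law, from the marginal envelope (A)
# (`stub_threeBodyCollisionSumLG_of_envelope`, crux stmt-AtomisticToContinuum-13481 `InformationPercolationEngine.CollisionRate`, line `Sketch`)

Port of the rung-0 theorem `Theorems.EvenStressEnskog.stub_threeBodyCollisionSumRung0` from the homogeneous (flow-invariant) Gibbs law to the TRUE local Gibbs law
`LG = localGibbsLaw σ a₀ u₀ θ₀ N (Φ N)`, given the MARGINAL ENVELOPE (A) of its evolved pair and triple laws on `[0, τ]` (hypothesis): for `N ≥ N₀`, `t ∈ [0, τ]` the laws of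
`(Φ_t z i, Φ_t z j)` and `(Φ_t z i, Φ_t z j, Φ_t z k)` under `LG` are `≤ C ×` the reference laws `(Haar ⊗ N(u, θ))^{⊗ 2}`, `(Haar ⊗ N(u, θ))^{⊗ 3}`.  The three-body collision sum
`N₃ = threeBodyCollisionSum σ N Φ τ L κ` (over the collisions `(s, p, q)`, `s ∈ (0, τ]`, the number of third particles in the near-contact shell `ε < ‖x_l − x_p‖ ≤ ε(1 + 2Lκ)`
of `p`) is, exactly as at rung 0, fed to the one-window machine with the window events `E_M(i, j)` cut from the swept tubes of mesh `τ/M` (`exists_sweptTube`,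
`exists_latticeVec_add_mem_of_contact`) and the free-flight majorant `F̃_M(w, i, j) = #{l ∉ {i, j} : ε ≤ dist(x_l, x_i) ≤ ε(1 + 2Lκ) + (τ/M)‖v_i − v_l‖}`
(`ofReal_shellCount_freeFlight_le`).  Two things change: (i) the stationary window bound becomes the NON-stationary Campbell–Fatou device
`exists_measurable_majorant_collisionSum_of_forall_le` (a measurable majorant `g` of the collision sum on the good set with `∫ g dLG ≤ liminf_M M · B_M`, given a bound `B_M`
of the one-window functional under EVERY law `(Φ_r)_* LG`, `r ∈ [0, τ]`; `lintegral_map_le` and the split of the window functional into `(N+1)N(N−1)` terms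
`𝟙_{E_M(i,j) ∩ D_M(i,l)}`, functions of `(w i, w j, w l)`, make the TRIPLE conjunct of (A) at time `r` the static input; then Markov for `g` and `LG(goodᶜ) = 0`); (ii) the
static three-label bound is the EXACT computation on the reference space (`lintegral_refWindowShell_le`): for fixed `(x_i, v_i)` the positions `x_j`, `x_l` are independent
Haar-uniform, the lifted tube has Haar measure `≤ 4ε²h‖v_i − v_j‖` (`volume_setOf_exists_reprSym_add_latticeVec_mem_le`), the thickened shell `≤ (28π/3)(2Lκ)ε³ + 5h‖v_i − v_l‖`
(`volume_shell_le`, Haar translation `Torus.volume_reprSym_sub_mem`), and the velocity weights are `≤ 1 + 2‖v_i‖² + ‖v_j‖² + ‖v_l‖²`, of Gaussian mean `1 + 4(‖u‖² + 3θ)`.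
Hence `M · B_M = A + B/M`, `A = (N+1)³ · C · 4ε²τ · (1 + 4(‖u‖² + 3θ)) · (28π/3)(2Lκ)ε³`, and the Markov normalisation `ε/(η(N+1))` gives the `N`-uniform bound
`LG{η < ε/(N+1) · N₃} ≤ 8 C (28π/3) τ (1 + 4(‖u‖² + 3θ)) L σ⁶ κ / η ≤ δ` for `κ < κ₀`, `N ≥ N₀`.

References: C. Cercignani, R. Illner, M. Pulvirenti, *The Mathematical Theory of Dilute Gases* (1994), §4.3, App. 4.A; I. Gallagher, L. Saint-Raymond, B. Texier,
*From Newton to Boltzmann* (2013), Prop. 4.1.1; H. Spohn, *Large Scale Dynamics of Interacting Particles* (1991), Part I §2.3.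
-/

open scoped BigOperators Topology Classical MeasureTheory ProbabilityTheory InnerProductSpace ENNReal
open Filter Set Function MeasureTheory
open Literature.Analysis.FluidPDE Literature.MathematicalPhysics.KineticTheory

namespace Summit.AtomisticToContinuum.HydrodynamicLimit.Theorems.CollisionRate

open Literature.Analysis.FunctionSpaces (Torus.latticeVec)
open Summit.AtomisticToContinuum.HydrodynamicLimit.Theorems.EvenStressEnskog (ofReal_shellCount_freeFlight_le volume_shell_le shellCount_nonneg)

/-! ### Statics on the reference product space `(Haar ⊗ N(u,θ))^{⊗ 3}` -/

/-- The three-label window–shell event read in the coordinates `(q_i, q_j, q_l)` of the reference space — a lift of `x_j − x_i` lies in the tube `S (v_i − v_j)`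
AND `x_l` lies in the thickened shell `ε ≤ dist(x_l, x_i) ≤ ε(1 + x) + h‖v_i − v_l‖` — is measurable for a jointly measurable tube family. [folklore] -/
theorem measurableSet_refWindowShell {ε x h : ℝ} {S : V3 → Set V3} (hSm : MeasurableSet {q : V3 × V3 | q.1 ∈ S q.2}) :
    MeasurableSet ({q : (T3 × V3) × (T3 × V3) × (T3 × V3) | ∃ k : Fin 3 → ℤ, Torus.reprSym (q.2.1.1 - q.1.1) + Torus.latticeVec k ∈ S (q.1.2 - q.2.1.2)} ∩
      {q | ε ≤ Torus.euclidDist q.2.2.1 q.1.1 ∧ Torus.euclidDist q.2.2.1 q.1.1 ≤ ε * (1 + x) + h * ‖q.1.2 - q.2.2.2‖}) := by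
  refine MeasurableSet.inter ?_ ?_
  · set ψ : (Fin 3 → ℤ) → (T3 × V3) × (T3 × V3) × (T3 × V3) → V3 × V3 := fun k q => (Torus.reprSym (q.2.1.1 - q.1.1) + Torus.latticeVec k, q.1.2 - q.2.1.2) with hψ
    have hψm : ∀ k, Measurable (ψ k) := fun k =>
      ((Torus.measurable_reprSym.comp ((measurable_fst.comp (measurable_fst.comp measurable_snd)).sub (measurable_fst.comp measurable_fst))).add_const _).prodMk
        ((measurable_snd.comp measurable_fst).sub (measurable_snd.comp (measurable_fst.comp measurable_snd)))
    have h1 : {q : (T3 × V3) × (T3 × V3) × (T3 × V3) | ∃ k : Fin 3 → ℤ, Torus.reprSym (q.2.1.1 - q.1.1) + Torus.latticeVec k ∈ S (q.1.2 - q.2.1.2)} =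
        ⋃ k, ψ k ⁻¹' {q : V3 × V3 | q.1 ∈ S q.2} := by ext q; simp only [hψ, mem_setOf_eq, mem_iUnion, mem_preimage]
    rw [h1]; exact MeasurableSet.iUnion fun k => hSm.preimage (hψm k)
  · have hdist : Measurable fun q : (T3 × V3) × (T3 × V3) × (T3 × V3) => Torus.euclidDist q.2.2.1 q.1.1 :=
      measurable_torusDist_comp (measurable_fst.comp (measurable_snd.comp measurable_snd)) (measurable_fst.comp measurable_fst)
    have hrad : Measurable fun q : (T3 × V3) × (T3 × V3) × (T3 × V3) => ε * (1 + x) + h * ‖q.1.2 - q.2.2.2‖ :=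
      measurable_const.add (measurable_const.mul ((measurable_snd.comp measurable_fst).sub (measurable_snd.comp (measurable_snd.comp measurable_snd))).norm)
    exact (measurableSet_le measurable_const hdist).inter (measurableSet_le hdist hrad)

/-- **Static three-label window bound on the reference space.** For `0 < ε ≤ 1/8`, `h ≥ 0`, `0 ≤ x ≤ 1` and a measurable swept-tube family `S` of volume `≤ 4ε²h‖v‖`,
the reference law `(Haar ⊗ N(u,θ))^{⊗ 3}` of the event "a lift of `x_j − x_i` lies in `S (v_i − v_j)` and `ε ≤ dist(x_l, x_i) ≤ ε(1 + x) + h‖v_i − v_l‖`" is at most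
`4ε²h · (1 + 4(‖u‖² + 3θ)) · ((28π/3) x ε³ + 5h)`: for fixed `(x_i, v_i)` and velocities the positions `x_j`, `x_l` are independent Haar-uniform (`Measure.prod_apply_symm`,
`lintegral_prod_mul`), the lifted tube has Haar measure `≤ vol S` (`volume_setOf_exists_reprSym_add_latticeVec_mem_le`), the thickened shell `≤ (28π/3) x ε³ + 5h‖v_i − v_l‖`
(`volume_shell_le` after a Haar translation), and the velocity weights are `≤ (1 + 2‖v_i‖² + ‖v_j‖² + ‖v_l‖²)((28π/3)xε³ + 5h)`, of Gaussian mean `(1 + 4(‖u‖² + 3θ))(…)`. [folklore] -/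
theorem lintegral_refWindowShell_le {ε : ℝ} (hε : 0 < ε) (hε8 : ε ≤ 1 / 8) (u : V3) {θ : ℝ} (hθ : 0 < θ) {h : ℝ} (hh : 0 ≤ h) {x : ℝ} (hx0 : 0 ≤ x) (hx1 : x ≤ 1)
    {S : V3 → Set V3} (hSm : MeasurableSet {q : V3 × V3 | q.1 ∈ S q.2}) (hSvol : ∀ v, volume (S v) ≤ ENNReal.ofReal (4 * ε ^ 2 * h * ‖v‖)) :
    ∫⁻ q, ({q : (T3 × V3) × (T3 × V3) × (T3 × V3) | ∃ k : Fin 3 → ℤ, Torus.reprSym (q.2.1.1 - q.1.1) + Torus.latticeVec k ∈ S (q.1.2 - q.2.1.2)} ∩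
      {q | ε ≤ Torus.euclidDist q.2.2.1 q.1.1 ∧ Torus.euclidDist q.2.2.1 q.1.1 ≤ ε * (1 + x) + h * ‖q.1.2 - q.2.2.2‖}).indicator 1 q
      ∂(((volume : Measure T3).prod (gaussMeasure u θ)).prod (((volume : Measure T3).prod (gaussMeasure u θ)).prod ((volume : Measure T3).prod (gaussMeasure u θ)))) ≤
    ENNReal.ofReal (4 * ε ^ 2 * h) * ENNReal.ofReal (1 + 4 * (‖u‖ ^ 2 + 3 * θ)) * (ENNReal.ofReal (28 * Real.pi / 3 * x * ε ^ 3) + ENNReal.ofReal (5 * h)) := by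
  set γ : Measure V3 := gaussMeasure u θ with hγ
  haveI hγP : IsProbabilityMeasure γ := by rw [hγ]; infer_instance
  set μ : Measure (T3 × V3) := (volume : Measure T3).prod γ with hμ
  haveI hμP : IsProbabilityMeasure μ := by rw [hμ]; infer_instance
  set m : ℝ := ‖u‖ ^ 2 + 3 * θ with hm
  have hm0 : 0 ≤ m := by rw [hm]; positivity
  set c : ℝ := 28 * Real.pi / 3 * x * ε ^ 3 with hc
  have hc0 : 0 ≤ c := by rw [hc]; positivity
  set K : ℝ≥0∞ := ENNReal.ofReal (4 * ε ^ 2 * h) * (ENNReal.ofReal c + ENNReal.ofReal (5 * h)) with hK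
  set A : Set ((T3 × V3) × (T3 × V3) × (T3 × V3)) := {q : (T3 × V3) × (T3 × V3) × (T3 × V3) |
      ∃ k : Fin 3 → ℤ, Torus.reprSym (q.2.1.1 - q.1.1) + Torus.latticeVec k ∈ S (q.1.2 - q.2.1.2)} ∩
    {q | ε ≤ Torus.euclidDist q.2.2.1 q.1.1 ∧ Torus.euclidDist q.2.2.1 q.1.1 ≤ ε * (1 + x) + h * ‖q.1.2 - q.2.2.2‖} with hA
  -- the slices of the event at a fixed first particle `a = (x_i, v_i)`, and their measurability
  set Ea : T3 × V3 → Set (T3 × V3) := fun a => {b | ∃ k : Fin 3 → ℤ, Torus.reprSym (b.1 - a.1) + Torus.latticeVec k ∈ S (a.2 - b.2)} with hEa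
  set Da : T3 × V3 → Set (T3 × V3) := fun a => {b | ε ≤ Torus.euclidDist b.1 a.1 ∧ Torus.euclidDist b.1 a.1 ≤ ε * (1 + x) + h * ‖a.2 - b.2‖} with hDa
  have hSu : ∀ v : V3, MeasurableSet (S v) := fun v => hSm.preimage (measurable_id.prodMk measurable_const)
  have hEam : ∀ a, MeasurableSet (Ea a) := by
    intro a
    have h1 : Ea a = ⋃ k : Fin 3 → ℤ, (fun b : T3 × V3 => (Torus.reprSym (b.1 - a.1) + Torus.latticeVec k, a.2 - b.2)) ⁻¹' {q : V3 × V3 | q.1 ∈ S q.2} := by ext b; simp only [hEa, mem_setOf_eq, mem_iUnion, mem_preimage]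
    rw [h1]; exact MeasurableSet.iUnion fun k => hSm.preimage (((Torus.measurable_reprSym.comp (measurable_fst.sub measurable_const)).add_const _).prodMk (measurable_const.sub measurable_snd))
  have hDam : ∀ a, MeasurableSet (Da a) := by
    intro a; have hdist : Measurable fun b : T3 × V3 => Torus.euclidDist b.1 a.1 := measurable_torusDist_comp measurable_fst measurable_const
    exact (measurableSet_le measurable_const hdist).inter (measurableSet_le hdist (measurable_const.add (measurable_const.mul (measurable_const.sub measurable_snd).norm)))
  -- (1) at fixed `a` the event is the product `Ea a × Da a`
  have hslice : ∀ (a : T3 × V3) (bc : (T3 × V3) × (T3 × V3)), (A.indicator 1 (a, bc) : ℝ≥0∞) = (Ea a).indicator 1 bc.1 * (Da a).indicator 1 bc.2 := by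
    intro a bc; have hmem : (a, bc) ∈ A ↔ bc.1 ∈ Ea a ∧ bc.2 ∈ Da a := Iff.rfl
    by_cases h1 : bc.1 ∈ Ea a
    · by_cases h2 : bc.2 ∈ Da a
      · simp only [indicator_of_mem (hmem.2 ⟨h1, h2⟩), indicator_of_mem h1, indicator_of_mem h2, Pi.one_apply, mul_one]
      · simp only [indicator_of_notMem (fun h' => h2 (hmem.1 h').2), indicator_of_notMem h2, mul_zero]
    · simp only [indicator_of_notMem (fun h' => h1 (hmem.1 h').1), indicator_of_notMem h1, zero_mul]
  -- (2) the partner: the Haar measure of the lifted tube (for every position `x_i`)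
  have hEa_le : ∀ a : T3 × V3, μ (Ea a) ≤ ∫⁻ v, ENNReal.ofReal (4 * ε ^ 2 * h * ‖a.2 - v‖) ∂γ := by
    intro a; rw [hμ, Measure.prod_apply_symm (hEam a)]; refine lintegral_mono fun v => ?_
    have hset : (fun y : T3 => (y, v)) ⁻¹' Ea a = {y : T3 | ∃ k : Fin 3 → ℤ, Torus.reprSym (y - a.1) + Torus.latticeVec k ∈ S (a.2 - v)} := rfl
    rw [hset]; exact (volume_setOf_exists_reprSym_add_latticeVec_mem_le a.1 (hSu (a.2 - v))).trans (hSvol _)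
  -- (3) the third particle: the Haar volume of the thickened shell (translation invariance)
  have hDa_le : ∀ a : T3 × V3, μ (Da a) ≤ ∫⁻ v, (ENNReal.ofReal c + ENNReal.ofReal (5 * (h * ‖a.2 - v‖))) ∂γ := by
    intro a; rw [hμ, Measure.prod_apply_symm (hDam a)]; refine lintegral_mono fun v => ?_
    set B : Set V3 := {p | ε ≤ ‖p‖ ∧ ‖p‖ ≤ ε * (1 + x) + h * ‖a.2 - v‖} with hB
    have hBm : MeasurableSet B := (measurableSet_le measurable_const measurable_norm).inter (measurableSet_le measurable_norm measurable_const)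
    have hset : (fun y : T3 => (y, v)) ⁻¹' Da a = {y : T3 | Torus.reprSym (y - a.1) ∈ B} := rfl
    have h0 := Torus.volume_reprSym_sub_mem (0 : T3) hBm
    simp only [sub_zero] at h0
    rw [hset, Torus.volume_reprSym_sub_mem a.1 hBm, ← h0]; exact volume_shell_le hε hε8 hx0 hx1 (by positivity)
  -- (4) the velocity weights, pointwise in the three velocities
  have hKe : K = ENNReal.ofReal (4 * ε ^ 2 * h * (c + 5 * h)) := by rw [hK, ← ENNReal.ofReal_add hc0 (by positivity), ← ENNReal.ofReal_mul (by positivity)]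
  have hptw : ∀ vi vj vl : V3, ENNReal.ofReal (4 * ε ^ 2 * h * ‖vi - vj‖) * (ENNReal.ofReal c + ENNReal.ofReal (5 * (h * ‖vi - vl‖))) ≤
      K * ENNReal.ofReal (1 + 2 * ‖vi‖ ^ 2 + ‖vj‖ ^ 2 + ‖vl‖ ^ 2) := by
    intro vi vj vl
    set e : ℝ := 1 + 2 * ‖vi‖ ^ 2 + ‖vj‖ ^ 2 + ‖vl‖ ^ 2 with he
    have he1 : ‖vi - vj‖ ≤ e := by rw [he]; nlinarith [norm_sub_le vi vj, sq_nonneg (‖vi‖ - 1), sq_nonneg (‖vj‖ - 1), sq_nonneg ‖vi‖, sq_nonneg ‖vl‖]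
    have he2 : ‖vi - vj‖ * ‖vi - vl‖ ≤ e := by
      have hp2 : ‖vi - vj‖ ^ 2 ≤ 2 * ‖vi‖ ^ 2 + 2 * ‖vj‖ ^ 2 := by nlinarith [norm_sub_le vi vj, norm_nonneg (vi - vj), sq_nonneg (‖vi‖ - ‖vj‖), norm_nonneg vi, norm_nonneg vj]
      have hq2 : ‖vi - vl‖ ^ 2 ≤ 2 * ‖vi‖ ^ 2 + 2 * ‖vl‖ ^ 2 := by nlinarith [norm_sub_le vi vl, norm_nonneg (vi - vl), sq_nonneg (‖vi‖ - ‖vl‖), norm_nonneg vi, norm_nonneg vl]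
      rw [he]; nlinarith [sq_nonneg (‖vi - vj‖ - ‖vi - vl‖)]
    have hL : ENNReal.ofReal (4 * ε ^ 2 * h * ‖vi - vj‖) * (ENNReal.ofReal c + ENNReal.ofReal (5 * (h * ‖vi - vl‖))) =
        ENNReal.ofReal (4 * ε ^ 2 * h * ‖vi - vj‖ * (c + 5 * (h * ‖vi - vl‖))) := by rw [← ENNReal.ofReal_add hc0 (by positivity), ← ENNReal.ofReal_mul (by positivity)]
    rw [hL, hKe, ← ENNReal.ofReal_mul (by positivity)]; refine ENNReal.ofReal_le_ofReal ?_
    have h1 : 4 * ε ^ 2 * h * ‖vi - vj‖ * (c + 5 * (h * ‖vi - vl‖)) = 4 * ε ^ 2 * h * (c * ‖vi - vj‖ + 5 * h * (‖vi - vj‖ * ‖vi - vl‖)) := by ring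
    have h2 : c * ‖vi - vj‖ + 5 * h * (‖vi - vj‖ * ‖vi - vl‖) ≤ c * e + 5 * h * e :=
      add_le_add (mul_le_mul_of_nonneg_left he1 hc0) (mul_le_mul_of_nonneg_left he2 (by positivity))
    rw [h1, show 4 * ε ^ 2 * h * (c + 5 * h) * e = 4 * ε ^ 2 * h * (c * e + 5 * h * e) by ring]; exact mul_le_mul_of_nonneg_left h2 (by positivity)
  -- (5) the Gaussian second moments
  have hvm : Measurable fun v : V3 => ENNReal.ofReal (‖v‖ ^ 2) := by fun_prop
  have hmom : ∫⁻ v, ENNReal.ofReal (‖v‖ ^ 2) ∂γ = ENNReal.ofReal m := by rw [hγ, hm]; exact lintegral_norm_sq_gaussMeasure u hθ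
  have hfst : ∫⁻ p : V3 × V3, ENNReal.ofReal (‖p.1‖ ^ 2) ∂(γ.prod γ) = ENNReal.ofReal m := by
    rw [← hmom]; exact (measurePreserving_fst (μ := γ) (ν := γ)).lintegral_comp (f := fun v : V3 => ENNReal.ofReal (‖v‖ ^ 2)) hvm
  have hsnd : ∫⁻ p : V3 × V3, ENNReal.ofReal (‖p.2‖ ^ 2) ∂(γ.prod γ) = ENNReal.ofReal m := by
    rw [← hmom]; exact (measurePreserving_snd (μ := γ) (ν := γ)).lintegral_comp (f := fun v : V3 => ENNReal.ofReal (‖v‖ ^ 2)) hvm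
  have hG1 : ∀ vi : V3, ∫⁻ p, ENNReal.ofReal (1 + 2 * ‖vi‖ ^ 2 + ‖p.1‖ ^ 2 + ‖p.2‖ ^ 2) ∂(γ.prod γ) = ENNReal.ofReal (1 + 2 * ‖vi‖ ^ 2 + 2 * m) := by
    intro vi
    have hsplit : ∀ p : V3 × V3, ENNReal.ofReal (1 + 2 * ‖vi‖ ^ 2 + ‖p.1‖ ^ 2 + ‖p.2‖ ^ 2) =
        ENNReal.ofReal (1 + 2 * ‖vi‖ ^ 2) + ENNReal.ofReal (‖p.1‖ ^ 2) + ENNReal.ofReal (‖p.2‖ ^ 2) := fun p => by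
      rw [ENNReal.ofReal_add (by positivity) (by positivity), ENNReal.ofReal_add (by positivity) (by positivity)]
    have hm1 : Measurable fun p : V3 × V3 => ENNReal.ofReal (‖p.1‖ ^ 2) := by fun_prop
    have hm2 : Measurable fun p : V3 × V3 => ENNReal.ofReal (‖p.2‖ ^ 2) := by fun_prop
    simp_rw [hsplit]
    rw [lintegral_add_right _ hm2, lintegral_add_right _ hm1, lintegral_const, measure_univ, mul_one, hfst, hsnd, ← ENNReal.ofReal_add (by positivity) hm0,
      ← ENNReal.ofReal_add (by positivity) hm0]
    congr 1; ring
  have houter : ∫⁻ a, ENNReal.ofReal (1 + 2 * ‖a.2‖ ^ 2 + 2 * m) ∂μ = ENNReal.ofReal (1 + 4 * m) := by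
    have hsplit : ∀ v : V3, ENNReal.ofReal (1 + 2 * ‖v‖ ^ 2 + 2 * m) = ENNReal.ofReal (1 + 2 * m) + 2 * ENNReal.ofReal (‖v‖ ^ 2) := fun v => by
      rw [show 1 + 2 * ‖v‖ ^ 2 + 2 * m = (1 + 2 * m) + 2 * ‖v‖ ^ 2 by ring, ENNReal.ofReal_add (by positivity) (by positivity), ENNReal.ofReal_mul (by norm_num), ENNReal.ofReal_ofNat]
    have hchg : ∫⁻ a, ENNReal.ofReal (1 + 2 * ‖a.2‖ ^ 2 + 2 * m) ∂μ = ∫⁻ v, ENNReal.ofReal (1 + 2 * ‖v‖ ^ 2 + 2 * m) ∂γ :=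
      (measurePreserving_snd (μ := (volume : Measure T3)) (ν := γ)).lintegral_comp (f := fun v : V3 => ENNReal.ofReal (1 + 2 * ‖v‖ ^ 2 + 2 * m)) (by fun_prop)
    rw [hchg]; simp_rw [hsplit]
    rw [lintegral_add_left measurable_const, lintegral_const_mul _ hvm, lintegral_const, measure_univ, mul_one, hmom, ← ENNReal.ofReal_ofNat 2,
      ← ENNReal.ofReal_mul (by norm_num), ← ENNReal.ofReal_add (by positivity) (by positivity)]
    congr 1; ring
  -- (6) assembly: Tonelli over the first particle, independence of the other two
  have hmf : ∀ vi : V3, Measurable fun v : V3 => ENNReal.ofReal (4 * ε ^ 2 * h * ‖vi - v‖) := fun vi => by fun_prop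
  have hmg : ∀ vi : V3, Measurable fun v : V3 => ENNReal.ofReal c + ENNReal.ofReal (5 * (h * ‖vi - v‖)) := fun vi => by fun_prop
  have hme : ∀ vi : V3, Measurable fun p : V3 × V3 => ENNReal.ofReal (1 + 2 * ‖vi‖ ^ 2 + ‖p.1‖ ^ 2 + ‖p.2‖ ^ 2) := fun vi => by fun_prop
  have hma : Measurable fun a : T3 × V3 => ENNReal.ofReal (1 + 2 * ‖a.2‖ ^ 2 + 2 * m) := by fun_prop
  calc ∫⁻ q, A.indicator 1 q ∂(μ.prod (μ.prod μ))
      ≤ ∫⁻ a, ∫⁻ bc, A.indicator 1 (a, bc) ∂(μ.prod μ) ∂μ := lintegral_prod_le _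
    _ = ∫⁻ a, μ (Ea a) * μ (Da a) ∂μ := by
        refine lintegral_congr fun a => ?_
        simp_rw [hslice a]
        rw [lintegral_prod_mul (measurable_one.indicator (hEam a)).aemeasurable (measurable_one.indicator (hDam a)).aemeasurable, lintegral_indicator_one (hEam a),
          lintegral_indicator_one (hDam a)]
    _ ≤ ∫⁻ a, (∫⁻ v, ENNReal.ofReal (4 * ε ^ 2 * h * ‖a.2 - v‖) ∂γ) * (∫⁻ v, (ENNReal.ofReal c + ENNReal.ofReal (5 * (h * ‖a.2 - v‖))) ∂γ) ∂μ :=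
        lintegral_mono fun a => mul_le_mul' (hEa_le a) (hDa_le a)
    _ = ∫⁻ a, ∫⁻ p, ENNReal.ofReal (4 * ε ^ 2 * h * ‖a.2 - p.1‖) * (ENNReal.ofReal c + ENNReal.ofReal (5 * (h * ‖a.2 - p.2‖))) ∂(γ.prod γ) ∂μ :=
        lintegral_congr fun a => (lintegral_prod_mul (hmf a.2).aemeasurable (hmg a.2).aemeasurable).symm
    _ ≤ ∫⁻ a, ∫⁻ p, K * ENNReal.ofReal (1 + 2 * ‖a.2‖ ^ 2 + ‖p.1‖ ^ 2 + ‖p.2‖ ^ 2) ∂(γ.prod γ) ∂μ := lintegral_mono fun a => lintegral_mono fun p => hptw a.2 p.1 p.2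
    _ = ∫⁻ a, K * ENNReal.ofReal (1 + 2 * ‖a.2‖ ^ 2 + 2 * m) ∂μ := lintegral_congr fun a => by rw [lintegral_const_mul _ (hme a.2), hG1 a.2]
    _ = K * ENNReal.ofReal (1 + 4 * m) := by rw [lintegral_const_mul _ hma, houter]
    _ = _ := by rw [hK]; ring

/-! ### The stub -/

/-- **T2c′ · the three-body collision sum under the evolved local Gibbs law, from the marginal envelope (A)** (registered stub `stub_threeBodyCollisionSumLG_of_envelope` of crux stmt-AtomisticToContinuum-13481, line `Sketch`, skeleton v21): port of `Theorems.EvenStressEnskog.stub_threeBodyCollisionSumRung0` with the stationarity step replaced by `exists_measurable_majorant_collisionSum_of_forall_le` and the window–shell statics supplied by the triple conjunct of (A). [folklore] -/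
theorem stub_threeBodyCollisionSumLG_of_envelope :
    (∀ (a₀ θ₀ : T3 → ℝ) (u₀ : T3 → V3), Continuous a₀ → Continuous θ₀ → Continuous u₀ → (∀ x, 0 < a₀ x) → (∀ x, 0 < θ₀ x) → ∃ σ₀ : ℝ, 0 < σ₀ ∧ ∀ σ : ℝ, 0 < σ → σ < σ₀ →
      ∀ Φ : (N : ℕ) → HardSphereFlow (Torus.geometry (Fin 3)) (hsDiameter σ N) (N + 1), ∀ τ : ℝ, 0 < τ → ∃ C : ℝ, 0 ≤ C ∧ ∃ u : V3, ∃ θ : ℝ, 0 < θ ∧ ∃ N₀ : ℕ, ∀ N : ℕ, N₀ ≤ N →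
      ∀ t ∈ Set.Icc (0 : ℝ) τ,
        (∀ i j : Fin (N + 1), i ≠ j → ∀ f : (T3 × V3) × (T3 × V3) → ℝ≥0∞, Measurable f →
          ∫⁻ z, f ((Φ N).flow t z i, (Φ N).flow t z j) ∂(localGibbsLaw σ a₀ u₀ θ₀ N (Φ N)) ≤
            ENNReal.ofReal C * ∫⁻ q, f q ∂(((volume : Measure T3).prod (gaussMeasure u θ)).prod ((volume : Measure T3).prod (gaussMeasure u θ)))) ∧
        (∀ i j k : Fin (N + 1), i ≠ j → i ≠ k → j ≠ k → ∀ f : (T3 × V3) × (T3 × V3) × (T3 × V3) → ℝ≥0∞, Measurable f →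
          ∫⁻ z, f ((Φ N).flow t z i, (Φ N).flow t z j, (Φ N).flow t z k) ∂(localGibbsLaw σ a₀ u₀ θ₀ N (Φ N)) ≤
            ENNReal.ofReal C * ∫⁻ q, f q ∂(((volume : Measure T3).prod (gaussMeasure u θ)).prod
              (((volume : Measure T3).prod (gaussMeasure u θ)).prod ((volume : Measure T3).prod (gaussMeasure u θ)))))) →
    ∀ (a₀ θ₀ : T3 → ℝ) (u₀ : T3 → V3), Continuous a₀ → Continuous θ₀ → Continuous u₀ → (∀ x, 0 < a₀ x) → (∀ x, 0 < θ₀ x) → ∃ σ₀ : ℝ, 0 < σ₀ ∧ ∀ σ : ℝ, 0 < σ → σ < σ₀ →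
      ∀ Φ : (N : ℕ) → HardSphereFlow (Torus.geometry (Fin 3)) (hsDiameter σ N) (N + 1), ∀ τ : ℝ, 0 < τ → ∀ η δ : ℝ, 0 < η → 0 < δ →
      ∀ L : ℝ, 1 ≤ L → ∃ κ₀ : ℝ, 0 < κ₀ ∧ ∀ κ : ℝ, 0 < κ → κ < κ₀ → ∃ N₀ : ℕ, ∀ N : ℕ, N₀ ≤ N →
        localGibbsLaw σ a₀ u₀ θ₀ N (Φ N) {z | η < hsDiameter σ N / (N + 1 : ℝ) * threeBodyCollisionSum σ N (Φ N) τ L κ z} ≤ ENNReal.ofReal δ := by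
  intro hA a₀ θ₀ u₀ ha₀ hθ₀ hu₀ ha₀0 hθ₀0
  obtain ⟨σA, hσA, hAσ⟩ := hA a₀ θ₀ u₀ ha₀ hθ₀ hu₀ ha₀0 hθ₀0
  refine ⟨min σA (1 / 8), lt_min hσA (by norm_num), fun σ hσ hσlt Φ τ hτ η δ hη hδ L hL => ?_⟩
  have hσ8 : σ ≤ 1 / 8 := (hσlt.trans_le (min_le_right _ _)).le
  have hL0 : 0 < L := one_pos.trans_le hL
  -- the envelope constants at the reduced diameter `σ`, the flow family `Φ` and the horizon `τ`; the constants
  obtain ⟨CA, hCA, u, θ, hθ, N₀, hAN⟩ := hAσ σ hσ (hσlt.trans_le (min_le_left _ _)) Φ τ hτ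
  set Kv : ℝ := 1 + 4 * (‖u‖ ^ 2 + 3 * θ) with hKv
  have hKv0 : 0 < Kv := by rw [hKv]; positivity
  set C : ℝ := 8 * CA * (28 * Real.pi / 3) * τ * Kv * L * σ ^ 6 with hC
  have hC0 : 0 ≤ C := by rw [hC]; positivity
  refine ⟨min (1 / (2 * L)) (η * δ / (C + 1)), lt_min (by positivity) (by positivity), fun κ hκ hκlt => ⟨N₀, fun N hN => ?_⟩⟩
  have hκL : 2 * L * κ ≤ 1 := by
    have h1 : κ < 1 / (2 * L) := hκlt.trans_le (min_le_left _ _)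
    rw [lt_div_iff₀ (by positivity)] at h1; linarith
  have hκC : C * κ / η ≤ δ := by
    have h1 : κ < η * δ / (C + 1) := hκlt.trans_le (min_le_right _ _)
    rw [lt_div_iff₀ (by positivity)] at h1; rw [div_le_iff₀ hη]; nlinarith
  -- notation
  set ε := hsDiameter σ N with hεdef
  have hε : 0 < ε := hsDiameter_pos hσ N
  have hε8 : ε ≤ 1 / 8 := (hsDiameter_le hσ.le N).trans hσ8
  set P := localGibbsLaw σ a₀ u₀ θ₀ N (Φ N) with hP
  -- the swept tubes, one for every mesh `τ / M`
  have htube : ∀ M : ℕ, ∃ S : V3 → Set V3, MeasurableSet {q : V3 × V3 | q.1 ∈ S q.2} ∧ (∀ v, volume (S v) ≤ ENNReal.ofReal (4 * ε ^ 2 * (τ / M) * ‖v‖)) ∧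
      ∀ (v r : V3) (s : ℝ), ε ≤ ‖r‖ → s ∈ Icc 0 (τ / M) → ‖r + s • v‖ = ε → r ∈ S v := fun M => exists_sweptTube hε (div_nonneg hτ.le (Nat.cast_nonneg M))
  choose S hSm hSvol hScov using htube
  -- the window events, the thickened shells, the majorant, the mark, and the three-label event read on the reference space
  set E : ℕ → Fin (N + 1) → Fin (N + 1) → Set (Config (N + 1) (Fin 3) T3) := fun M i j =>
    {w | ∃ k : Fin 3 → ℤ, Torus.reprSym ((w j).1 - (w i).1) + Torus.latticeVec k ∈ S M ((w i).2 - (w j).2)} with hE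
  set D : ℕ → Fin (N + 1) → Fin (N + 1) → Set (Config (N + 1) (Fin 3) T3) := fun M i l =>
    {w | ε ≤ Torus.euclidDist (w l).1 (w i).1 ∧ Torus.euclidDist (w l).1 (w i).1 ≤ ε * (1 + 2 * L * κ) + τ / M * ‖(w i).2 - (w l).2‖} with hD
  set Ft : ℕ → Config (N + 1) (Fin 3) T3 → Fin (N + 1) → Fin (N + 1) → ℝ≥0∞ := fun M w i j => ∑ l, if l ≠ i ∧ l ≠ j then (D M i l).indicator 1 w else 0 with hFt
  set F : Config (N + 1) (Fin 3) T3 → Fin (N + 1) → Fin (N + 1) → ℝ≥0∞ := fun w i _ => ENNReal.ofReal (shellCount σ N L κ w i) with hF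
  set A3 : ℕ → Set ((T3 × V3) × (T3 × V3) × (T3 × V3)) := fun M =>
    {q : (T3 × V3) × (T3 × V3) × (T3 × V3) | ∃ k : Fin 3 → ℤ, Torus.reprSym (q.2.1.1 - q.1.1) + Torus.latticeVec k ∈ S M (q.1.2 - q.2.1.2)} ∩
      {q | ε ≤ Torus.euclidDist q.2.2.1 q.1.1 ∧ Torus.euclidDist q.2.2.1 q.1.1 ≤ ε * (1 + 2 * L * κ) + τ / M * ‖q.1.2 - q.2.2.2‖} with hA3
  have hA3m : ∀ M, MeasurableSet (A3 M) := fun M => measurableSet_refWindowShell (hSm M)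
  have hind : ∀ (M : ℕ) (i j l : Fin (N + 1)) (w : Config (N + 1) (Fin 3) T3), ((E M i j ∩ D M i l).indicator 1 w : ℝ≥0∞) = (A3 M).indicator 1 (w i, w j, w l) :=
    fun M i j l w => rfl
  -- measurability
  have hEm : ∀ M i j, MeasurableSet (E M i j) := by
    intro M i j
    set ψ : (Fin 3 → ℤ) → Config (N + 1) (Fin 3) T3 → V3 × V3 := fun k w => (Torus.reprSym ((w j).1 - (w i).1) + Torus.latticeVec k, (w i).2 - (w j).2) with hψ
    have hψm : ∀ k, Measurable (ψ k) := fun k =>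
      ((Torus.measurable_reprSym.comp ((measurable_pi_apply j).fst.sub (measurable_pi_apply i).fst)).add_const _).prodMk ((measurable_pi_apply i).snd.sub (measurable_pi_apply j).snd)
    have h1 : E M i j = ⋃ k, ψ k ⁻¹' {q : V3 × V3 | q.1 ∈ S M q.2} := by ext w; simp only [hE, hψ, mem_setOf_eq, mem_iUnion, mem_preimage]
    rw [h1]; exact MeasurableSet.iUnion fun k => (hSm M).preimage (hψm k)
  have hDm : ∀ M i l, MeasurableSet (D M i l) := by
    intro M i l
    have hdist : Measurable fun w : Config (N + 1) (Fin 3) T3 => Torus.euclidDist (w l).1 (w i).1 := measurable_torusDist_comp (measurable_pi_apply l).fst (measurable_pi_apply i).fst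
    exact (measurableSet_le measurable_const hdist).inter
      (measurableSet_le hdist (measurable_const.add (measurable_const.mul ((measurable_pi_apply i).snd.sub (measurable_pi_apply l).snd).norm)))
  have hFtm : ∀ M i j, Measurable fun w => Ft M w i j := by
    intro M i j; simp only [hFt]; refine Finset.measurable_sum _ fun l _ => ?_
    by_cases hl : l ≠ i ∧ l ≠ j
    · simp only [if_pos hl]; exact measurable_one.indicator (hDm M i l)
    · simp only [if_neg hl]; exact measurable_const
  -- (i) the windows cover the backward contacts; (ii) the majorant of the mark along the windows
  have hEcov : ∀ (M : ℕ) (i j : Fin (N + 1)), i ≠ j → ∀ w ∈ hardSphereDomain (Torus.geometry (Fin 3)) (N + 1) ε, ∀ t ∈ Icc 0 (τ / M),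
      ‖(Torus.geometry (Fin 3)).sepVec ((freeFlight (Torus.geometry (Fin 3)) (-t) w i).1) ((freeFlight (Torus.geometry (Fin 3)) (-t) w j).1)‖ = ε → w ∈ E M i j := by
    intro M i j hij w hw t ht hc
    have hc' : ‖(Torus.geometry (Fin 3)).sepVec ((freeFlight (Torus.geometry (Fin 3)) (-t) w j).1) ((freeFlight (Torus.geometry (Fin 3)) (-t) w i).1)‖ = ε := by rw [Torus.norm_geometry_sepVec, Torus.euclidDist_comm, ← Torus.norm_geometry_sepVec, hc]
    exact exists_latticeVec_add_mem_of_contact (hScov M) hw hij.symm ht hc'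
  have hFtle : ∀ (M : ℕ) (i j : Fin (N + 1)), i ≠ j → ∀ w ∈ hardSphereDomain (Torus.geometry (Fin 3)) (N + 1) ε, ∀ t ∈ Icc 0 (τ / M),
      ‖(Torus.geometry (Fin 3)).sepVec ((freeFlight (Torus.geometry (Fin 3)) (-t) w i).1) ((freeFlight (Torus.geometry (Fin 3)) (-t) w j).1)‖ = ε →
        F (freeFlight (Torus.geometry (Fin 3)) (-t) w) i j ≤ Ft M w i j := fun M i j _ w hw t ht hc => ofReal_shellCount_freeFlight_le hσ L κ hw ht hc
  -- (iii) the one-window bound under EVERY law `(Φ_r)_* P`, `r ∈ [0, τ]`: the triple conjunct of (A)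
  set n : ℝ≥0∞ := ((N + 1 : ℕ) : ℝ≥0∞) with hn
  set cκ : ℝ := 28 * Real.pi / 3 * (2 * L * κ) * ε ^ 3 with hcκ
  obtain ⟨B, hBM⟩ : ∃ B : ℕ → ℝ≥0∞, ∀ M : ℕ,
      B M = n ^ 3 * (ENNReal.ofReal CA * (ENNReal.ofReal (4 * ε ^ 2 * (τ / M)) * ENNReal.ofReal Kv * (ENNReal.ofReal cκ + ENNReal.ofReal (5 * (τ / M))))) := ⟨_, fun M => rfl⟩
  have hB : ∀ (M : ℕ), ∀ r ∈ Icc (0 : ℝ) (0 + τ), ∫⁻ w, ∑ i, ∑ j, (if i ≠ j then (E M i j).indicator (fun w => Ft M w i j) w else 0) ∂(P.map ((Φ N).flow r)) ≤ B M := by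
    intro M r hr
    rw [zero_add] at hr
    have hh : 0 ≤ τ / M := div_nonneg hτ.le (Nat.cast_nonneg M)
    set term : ℝ≥0∞ := ENNReal.ofReal CA * (ENNReal.ofReal (4 * ε ^ 2 * (τ / M)) * ENNReal.ofReal Kv * (ENNReal.ofReal cκ + ENNReal.ofReal (5 * (τ / M)))) with hterm
    -- the static three-label bound, transported by the triple conjunct of (A) at the time `r`
    have htriple : ∀ i j l : Fin (N + 1), i ≠ j → i ≠ l → j ≠ l → ∫⁻ z, (E M i j ∩ D M i l).indicator 1 ((Φ N).flow r z) ∂P ≤ term := by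
      intro i j l hij hil hjl
      have h1 := (hAN N hN r hr).2 i j l hij hil hjl ((A3 M).indicator 1) (measurable_one.indicator (hA3m M))
      have h2 : ∫⁻ z, (E M i j ∩ D M i l).indicator 1 ((Φ N).flow r z) ∂P = ∫⁻ z, (A3 M).indicator 1 ((Φ N).flow r z i, (Φ N).flow r z j, (Φ N).flow r z l) ∂P :=
        lintegral_congr fun z => hind M i j l _
      rw [h2, hterm]; exact h1.trans (mul_le_mul' le_rfl (lintegral_refWindowShell_le hε hε8 u hθ hh (by positivity) hκL (hSm M) (hSvol M)))
    have hpair : ∀ i j : Fin (N + 1), ∫⁻ w, (if i ≠ j then (E M i j).indicator (fun w => Ft M w i j) w else 0) ∂(P.map ((Φ N).flow r)) ≤ ∑ _l : Fin (N + 1), term := by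
      intro i j; by_cases hij : i ≠ j
      · simp only [if_pos hij]
        have hpt : ∀ w, (E M i j).indicator (fun w => Ft M w i j) w ≤ ∑ l, (if l ≠ i ∧ l ≠ j then (E M i j ∩ D M i l).indicator 1 w else 0) := by
          intro w; by_cases hw : w ∈ E M i j
          · rw [indicator_of_mem hw]; simp only [hFt]
            refine Finset.sum_le_sum fun l _ => ?_
            split_ifs
            · by_cases hwD : w ∈ D M i l
              · rw [indicator_of_mem hwD, indicator_of_mem (mem_inter hw hwD)]
              · rw [indicator_of_notMem hwD]; exact bot_le
            · exact le_rfl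
          · rw [indicator_of_notMem hw]; exact bot_le
        have hmeas : ∀ l, Measurable fun z : Config (N + 1) (Fin 3) T3 => (if l ≠ i ∧ l ≠ j then (E M i j ∩ D M i l).indicator 1 ((Φ N).flow r z) else 0 : ℝ≥0∞) := by
          intro l; by_cases hl : l ≠ i ∧ l ≠ j
          · simp only [if_pos hl]; exact (measurable_one.indicator ((hEm M i j).inter (hDm M i l))).comp ((Φ N).measurable_flow r)
          · simp only [if_neg hl]; exact measurable_const
        calc ∫⁻ w, (E M i j).indicator (fun w => Ft M w i j) w ∂(P.map ((Φ N).flow r))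
            ≤ ∫⁻ z, (E M i j).indicator (fun w => Ft M w i j) ((Φ N).flow r z) ∂P := lintegral_map_le _ _
          _ ≤ ∫⁻ z, ∑ l, (if l ≠ i ∧ l ≠ j then (E M i j ∩ D M i l).indicator 1 ((Φ N).flow r z) else 0) ∂P := lintegral_mono fun z => hpt _
          _ = ∑ l, ∫⁻ z, (if l ≠ i ∧ l ≠ j then (E M i j ∩ D M i l).indicator 1 ((Φ N).flow r z) else 0) ∂P := lintegral_finsetSum _ fun l _ => hmeas l
          _ ≤ ∑ _l, term := by
              refine Finset.sum_le_sum fun l _ => ?_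
              by_cases hl : l ≠ i ∧ l ≠ j
              · simp only [if_pos hl]; exact htriple i j l hij hl.1.symm hl.2.symm
              · simp only [if_neg hl, lintegral_zero, zero_le]
      · simp only [if_neg hij, lintegral_zero, zero_le]
    have hmeasij : ∀ i j : Fin (N + 1), Measurable fun w : Config (N + 1) (Fin 3) T3 => (if i ≠ j then (E M i j).indicator (fun w => Ft M w i j) w else 0) := by
      intro i j; by_cases hij : i ≠ j
      · simp only [if_pos hij]; exact (hFtm M i j).indicator (hEm M i j)
      · simp only [if_neg hij]; exact measurable_const
    calc ∫⁻ w, ∑ i, ∑ j, (if i ≠ j then (E M i j).indicator (fun w => Ft M w i j) w else 0) ∂(P.map ((Φ N).flow r))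
        = ∑ i, ∑ j, ∫⁻ w, (if i ≠ j then (E M i j).indicator (fun w => Ft M w i j) w else 0) ∂(P.map ((Φ N).flow r)) := by
          rw [lintegral_finsetSum _ fun i _ => Finset.measurable_sum _ fun j _ => hmeasij i j]
          exact Finset.sum_congr rfl fun i _ => lintegral_finsetSum _ fun j _ => hmeasij i j
      _ ≤ ∑ _i : Fin (N + 1), ∑ _j : Fin (N + 1), ∑ _l : Fin (N + 1), term := by gcongr with i _ j _; exact hpair i j
      _ = B M := by rw [hBM M]; simp only [Finset.sum_const, Finset.card_univ, Fintype.card_fin, nsmul_eq_mul, hn, hterm]; ring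
  -- the non-stationary window inequality: a measurable majorant of the collision sum of `F` on `[0, τ]`
  obtain ⟨g, hgm, hdom, hint⟩ := exists_measurable_majorant_collisionSum_of_forall_le (Φ N) P hτ 0 F E hEm hEcov Ft hFtm hFtle B hB
  simp only [zero_add] at hdom
  -- (iv) the event lies in the Markov event of the majorant up to the bad set
  set η₁ : ℝ := η * (N + 1 : ℝ) / ε with hη₁
  have hη₁0 : 0 < η₁ := by rw [hη₁]; positivity
  have hsub : {z | η < ε / (N + 1 : ℝ) * threeBodyCollisionSum σ N (Φ N) τ L κ z} ⊆ (Φ N).goodᶜ ∪ {z | ENNReal.ofReal η₁ ≤ g z} := by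
    intro z hz; by_cases hgood : z ∈ (Φ N).good
    · refine Or.inr ?_
      have hγ := (Φ N).isTrajectory z hgood; have hfin := hγ.locFinite 0 τ
      have hfin' : (collisionTimes (Torus.geometry (Fin 3)) ε (orbit σ N (Φ N) z) ∩ Ioc 0 τ).Finite := hfin.subset (inter_subset_inter_right _ Ioc_subset_Icc_self)
      have h3 : threeBodyCollisionSum σ N (Φ N) τ L κ z =
          ∑ t ∈ hfin'.toFinset, ∑ p ∈ contactPairs (Torus.geometry (Fin 3)) ε (orbit σ N (Φ N) z t), shellCount σ N L κ (orbit σ N (Φ N) z t) p.1 := by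
        unfold threeBodyCollisionSum; exact collisionPairSum_eq_finset_sum hfin' _
      have hK : ENNReal.ofReal (threeBodyCollisionSum σ N (Φ N) τ L κ z) ≤ ∑ᶠ s ∈ collisionTimes (Torus.geometry (Fin 3)) ε (fun t => (Φ N).flow t z) ∩ Icc 0 τ,
            ∑ i, ∑ j, (if i ≠ j ∧ ‖(Torus.geometry (Fin 3)).sepVec ((Φ N).flow s z i).1 ((Φ N).flow s z j).1‖ = ε then F ((Φ N).flow s z) i j else 0) := by
        rw [finsum_mem_eq_finite_toFinset_sum _ hfin, h3, ENNReal.ofReal_sum_of_nonneg fun t _ => Finset.sum_nonneg fun p _ => shellCount_nonneg L κ _ _]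
        calc ∑ t ∈ hfin'.toFinset, ENNReal.ofReal (∑ p ∈ contactPairs (Torus.geometry (Fin 3)) ε (orbit σ N (Φ N) z t), shellCount σ N L κ (orbit σ N (Φ N) z t) p.1)
            = ∑ t ∈ hfin'.toFinset, ∑ p ∈ contactPairs (Torus.geometry (Fin 3)) ε (orbit σ N (Φ N) z t), F (orbit σ N (Φ N) z t) p.1 p.2 :=
              Finset.sum_congr rfl fun t _ => ENNReal.ofReal_sum_of_nonneg fun p _ => shellCount_nonneg L κ _ _
          _ ≤ ∑ t ∈ hfin.toFinset, ∑ p ∈ contactPairs (Torus.geometry (Fin 3)) ε (orbit σ N (Φ N) z t), F (orbit σ N (Φ N) z t) p.1 p.2 :=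
              Finset.sum_le_sum_of_subset (Set.Finite.toFinset_subset_toFinset.2 (inter_subset_inter_right _ Ioc_subset_Icc_self))
          _ = _ := Finset.sum_congr rfl fun t _ => sum_contactPairs_eq (hγ.mem t) (fun i j => F (orbit σ N (Φ N) z t) i j)
      have hlt : η₁ < threeBodyCollisionSum σ N (Φ N) τ L κ z := by
        have h1 : η < ε / (N + 1 : ℝ) * threeBodyCollisionSum σ N (Φ N) τ L κ z := hz
        rw [div_mul_eq_mul_div, lt_div_iff₀ (by positivity)] at h1; rw [hη₁, div_lt_iff₀ hε]; linarith
      exact ((ENNReal.ofReal_le_ofReal hlt.le).trans hK).trans (hdom z hgood)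
    · exact Or.inl hgood
  -- (v) `M · B M = A + B' / M`, so the `liminf` over the mesh kills the thickening error
  set A : ℝ≥0∞ := n ^ 3 * (ENNReal.ofReal CA * (ENNReal.ofReal (4 * ε ^ 2 * τ) * ENNReal.ofReal Kv * ENNReal.ofReal cκ)) with hAdef
  set B' : ℝ≥0∞ := n ^ 3 * (ENNReal.ofReal CA * (ENNReal.ofReal (4 * ε ^ 2 * τ) * ENNReal.ofReal Kv * ENNReal.ofReal (5 * τ))) with hB'def
  have hB'top : B' ≠ ∞ := ENNReal.mul_ne_top (ENNReal.pow_ne_top (ENNReal.natCast_ne_top _))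
    (ENNReal.mul_ne_top ENNReal.ofReal_ne_top (ENNReal.mul_ne_top (ENNReal.mul_ne_top ENNReal.ofReal_ne_top ENNReal.ofReal_ne_top) ENNReal.ofReal_ne_top))
  have hMB : ∀ M : ℕ, (M : ℝ≥0∞) * B M ≤ A + B' * (M : ℝ≥0∞)⁻¹ := by
    intro M; rcases Nat.eq_zero_or_pos M with hM0 | hM0
    · subst hM0; simp only [Nat.cast_zero, zero_mul, zero_le]
    have hM' : (0 : ℝ) < M := by exact_mod_cast hM0
    have h1 : (M : ℝ≥0∞) = ENNReal.ofReal (M : ℝ) := (ENNReal.ofReal_natCast M).symm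
    have h2 : (M : ℝ≥0∞) * ENNReal.ofReal (4 * ε ^ 2 * (τ / M)) = ENNReal.ofReal (4 * ε ^ 2 * τ) := by
      rw [h1, ← ENNReal.ofReal_mul (Nat.cast_nonneg _)]; congr 1; field_simp
    have h3 : ENNReal.ofReal (5 * (τ / M)) = ENNReal.ofReal (5 * τ) * (M : ℝ≥0∞)⁻¹ := by rw [h1, ← div_eq_mul_inv, ← ENNReal.ofReal_div_of_pos hM', mul_div_assoc]
    rw [hBM M, h3, hAdef, hB'def, ← h2]; exact le_of_eq (by ring)
  have hlim : liminf (fun M : ℕ => (M : ℝ≥0∞) * B M) atTop ≤ A := by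
    have ht : Tendsto (fun M : ℕ => A + B' * (M : ℝ≥0∞)⁻¹) atTop (𝓝 (A + B' * 0)) :=
      tendsto_const_nhds.add (ENNReal.Tendsto.const_mul ENNReal.tendsto_inv_nat_nhds_zero (Or.inr hB'top))
    rw [mul_zero, add_zero] at ht; exact (liminf_le_liminf (Eventually.of_forall hMB)).trans ht.liminf_eq.le
  -- (vi) the arithmetic of the constants, Markov for the majorant, `P(goodᶜ) = 0`
  have hgood0 : P (Φ N).goodᶜ = 0 := by rw [hP, localGibbsLaw_eq]; exact localGibbsMeasure_absolutelyContinuous σ _ _ _ N (Φ N) (Φ N).measure_compl_good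
  have hε3 : ((N + 1 : ℕ) : ℝ) * ε ^ 3 = σ ^ 3 := succ_mul_hsDiameter_pow_three σ N
  have hkey : (ENNReal.ofReal η₁)⁻¹ * A = ENNReal.ofReal (C * κ / η) := by
    rw [hAdef, hn, ← ENNReal.ofReal_inv_of_pos hη₁0, ← ENNReal.ofReal_natCast, ← ENNReal.ofReal_pow (Nat.cast_nonneg _), ← ENNReal.ofReal_mul (by positivity),
      ← ENNReal.ofReal_mul (by positivity), ← ENNReal.ofReal_mul (by positivity), ← ENNReal.ofReal_mul (by positivity), ← ENNReal.ofReal_mul (by positivity)]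
    have hσ6 : σ ^ 6 = (((N + 1 : ℕ) : ℝ) * ε ^ 3) ^ 2 := by rw [hε3]; ring
    congr 1; rw [hη₁, hC, hσ6, hcκ]; push_cast; field_simp; ring
  calc P {z | η < ε / (N + 1 : ℝ) * threeBodyCollisionSum σ N (Φ N) τ L κ z}
      ≤ P ((Φ N).goodᶜ ∪ {z | ENNReal.ofReal η₁ ≤ g z}) := measure_mono hsub
    _ ≤ P (Φ N).goodᶜ + P {z | ENNReal.ofReal η₁ ≤ g z} := measure_union_le _ _
    _ ≤ 0 + (∫⁻ z, g z ∂P) / ENNReal.ofReal η₁ := by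
        rw [hgood0]; exact add_le_add le_rfl (meas_ge_le_lintegral_div hgm.aemeasurable (ENNReal.ofReal_pos.2 hη₁0).ne' ENNReal.ofReal_ne_top)
    _ ≤ (ENNReal.ofReal η₁)⁻¹ * A := by rw [zero_add, ENNReal.div_eq_inv_mul]; exact mul_le_mul' le_rfl (hint.trans hlim)
    _ = ENNReal.ofReal (C * κ / η) := hkey
    _ ≤ ENNReal.ofReal δ := ENNReal.ofReal_le_ofReal hκC

end Summit.AtomisticToContinuum.HydrodynamicLimit.Theorems.CollisionRate
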